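/-
Copyright (c) 2026 the pub-hodgecm-mathlib formalisation cell (harness21).  Prover seat hodgecm-mathlib-A-p12 (g22), 2026-09-01.  Road «S3-tree» (architect A-p16 (g30)
A-94 (2) ∕ A-97 «P-1 ASSEMBLY»), brick T3′ «depth-zero κ-transfer», THE TYPE-(1) ASSEMBLY (part 1∕3: counts) — over the ★ organs of F0P3b-p01 (g11) (socket, unit row), A-p12 (g21)
(ROW-0), A-p19 (g25) (ROW-2), F0P3a-p03 (g15) (O8c H-values).
-/
import Literature.NumberTheory.Rogawski1990.DepthZeroKappaTransferTypeOneUnitRow              -- ★ p846155 values + UNIT ROW at the four literals (F0P3b-p01 (g11))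
import Literature.NumberTheory.Rogawski1990.DepthZeroKappaTransferTypeOneRowZero              -- ★ p846355 ROW-0 per literal (A-p12 (g21))
import Literature.NumberTheory.Rogawski1990.DepthZeroKappaTransferTypeOneRowTwo               -- ★ p846404 ROW-2 at a θ̄ = 1 literal (A-p19 (g25))
import Literature.NumberTheory.Rogawski1990.DepthZeroKappaTransferTypeOneRowTwoThetaZero      -- ★ p846432 ROW-2 at the θ̄ = 0 literal (A-p19 (g25))
import Literature.NumberTheory.Rogawski1990.UnitaryVertexStabilizerSpanCM                     -- ★ `v_charpoly_coeff_le_one_of_residuallyUnipotent` (A-p16 (g29))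
import HarnessLib

/-!
# T3′ (P-1), TYPE ONE — part 1∕3: deep eigenvalues, the κ-signed free row, the three strata counts of a literal

Topic `NumberTheory/Rogawski1990`; namespace `Literature.NumberTheory.Rogawski1990`.  Cell `pub/hodgecm-mathlib`, crux H413; road «S3-tree», brick T3′ «depth-zero κ-transfer»
(DESIGN v2 §2 (P-1), HEAD v4 8caecb47); the assembly `depthZeroKappaTransfer_hyperspecial_typeOne` is part 3∕3 (`DepthZeroKappaTransferTypeOne.lean`).
HONEST LABEL: HC_CM is proved only modulo the cell's 2 remaining named inputs (hLiu418 24832, h413 24833) until rung 0 closes; this file asserts nothing printed — it is an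
assembly of ★ organs.  THEOREMS ONLY (no definition, no instance, no notation, no named fact, no `sorry`); kernel lane `--supports stmt-HodgeConjecture-24833`.

* §1 `valuation_sub_one_lt_one_of_isRoot_charpoly_of_residuallyUnipotent` — a root of a residually-`(X−1)³` cubic characteristic polynomial is `≡ 1 (mod 𝔪)` (the
  DEEPNESS of the three eigenvalues `α, γ, u_w` of `ι_v(γ_H)_w` on the residually-unipotent locus ★ `setOf_residuallyUnipotent_endoEmbLocal_mem_nhds_one`).
* §2 `kappa_free_row` — the κ-signed ROW 2 of the four literals: eight parity cases give `(−1)^{N₁+N₂}(q+1)²q^{N₁+N₂+N−2}`.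
* §3 `rankStrata_counts_of_congr_flickerTorusElt{,One}` — at a literal `t_π(x₁,x₂,x₃)` ∕ `t_1(x₁,x₂,x₃)` the three Jordan-strata counts of `Fix_t(G′_v ⧸ K_v)` are
  functions of the exponents `P, Q₁, Q₂` alone: `n₀` = ★ ROW-0, `n₂` = ★ ROW-2, `n₀ + n₁ + n₂` = ★ unit row (binders = the union of the three ★ heads').

## References
* [Rogawski1990] J. D. Rogawski, *Automorphic Representations of Unitary Groups in Three Variables*, Ann. of Math. Stud. 123 (1990): §4.9 Prop. 4.9.1 (a)(b) pp. 54–55,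
  Lemma 4.9.3 p. 56; §4.3 (4.3.1)–(4.3.2) p. 43; §8.1 Prop. 8.1.1 p. 112; §3.1 p. 19.
* [Flicker1998UnitaryFL] Y. Z. Flicker, *Elementary proof of the fundamental lemma for a unitary group*, Canad. J. Math. 50 (1998): Prop. 3 p. 78, Props. 11–14 pp. 87–94,
  §6 Thm. 15 p. 95.
* [LanglandsShelstad1987] R. P. Langlands, D. Shelstad, *On the definition of transfer factors*, Math. Ann. 278 (1987): §1.3–1.4.
* [Kottwitz1986] R. Kottwitz, *Base change for unit elements of Hecke algebras*, Compositio Math. 60 (1986): §3.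
-/

set_option autoImplicit false

noncomputable section

open MeasureTheory Measure Set Function NumberField IsDedekindDomain Matrix Polynomial Topology Filter
open Literature.NumberTheory.Automorphic Literature.NumberTheory.Automorphic.UnitaryGroup
open Literature.NumberTheory.Automorphic.IntegralReduction Literature.NumberTheory.GaloisRepresentations
open scoped Matrix MatrixGroups ValuativeRel

namespace Literature.NumberTheory.Rogawski1990

/-! ## §1 Deep eigenvalues from a residually unipotent characteristic polynomial -/

section Deep

variable {K : Type*} [Field K] [Valued K (WithZero (Multiplicative ℤ))]

/-- **A root of a residually-`(X−1)³` monic cubic is `≡ 1`**: if `|coeff_i p − coeff_i (charpoly 1)| < 1` for `i < 3` (`p = charpoly A`, `A ∈ M₃(K)`) and `p(x) = 0`,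
then `|x − 1| < 1` (first `|x| ≤ 1` by domination of the cubic term — ★ `v_charpoly_coeff_le_one_of_residuallyUnipotent` gives integral coefficients —, then
`(x−1)³ = (charpoly 1 − p)(x)` has valuation `< 1`). [cite: Rogawski1990, §3.1 p. 19; §4.9 p. 54] -/
theorem valuation_sub_one_lt_one_of_isRoot_charpoly_of_residuallyUnipotent (A : Matrix (Fin 3) (Fin 3) K)
    (h : ∀ i < 3, Valued.v (A.charpoly.coeff i - (1 : Matrix (Fin 3) (Fin 3) K).charpoly.coeff i) < 1) {x : K} (hx : A.charpoly.IsRoot x) :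
    Valued.v (x - 1) < 1 := by
  have hcoef := v_charpoly_coeff_le_one_of_residuallyUnipotent A h
  have hdegA : A.charpoly.natDegree = 3 := by rw [Matrix.charpoly_natDegree_eq_dim, Fintype.card_fin]
  have hdeg1 : (1 : Matrix (Fin 3) (Fin 3) K).charpoly.natDegree = 3 := by rw [Matrix.charpoly_natDegree_eq_dim, Fintype.card_fin]
  have hc3 : A.charpoly.coeff 3 = 1 := by
    have h3 := (Matrix.charpoly_monic A).coeff_natDegree; rwa [hdegA] at h3
  have hb3 : (1 : Matrix (Fin 3) (Fin 3) K).charpoly.coeff 3 = 1 := by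
    have h3 := (Matrix.charpoly_monic (1 : Matrix (Fin 3) (Fin 3) K)).coeff_natDegree; rwa [hdeg1] at h3
  -- (a) `|x| ≤ 1`
  have hx1 : Valued.v x ≤ 1 := by
    by_contra hlt
    rw [not_le] at hlt
    have heval : A.charpoly.coeff 0 + A.charpoly.coeff 1 * x + A.charpoly.coeff 2 * x ^ 2 + x ^ 3 = 0 := by
      have h0 := hx.eq_zero
      rw [Polynomial.eval_eq_sum_range, hdegA] at h0
      simpa only [Finset.sum_range_succ, Finset.sum_range_zero, zero_add, pow_zero, mul_one, pow_one, hc3, one_mul] using h0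
    have e : x ^ 3 = -(A.charpoly.coeff 0 + A.charpoly.coeff 1 * x + A.charpoly.coeff 2 * x ^ 2) := by linear_combination heval
    have key : Valued.v x ^ 3 ≤ Valued.v x ^ 2 := by
      rw [← Valuation.map_pow, e, Valuation.map_neg]
      refine (Valuation.map_add _ _ _).trans (max_le ((Valuation.map_add _ _ _).trans (max_le ?_ ?_)) ?_)
      · exact (hcoef 0).trans (one_le_pow₀ hlt.le)
      · rw [Valuation.map_mul]
        calc Valued.v (A.charpoly.coeff 1) * Valued.v x ≤ 1 * Valued.v x := mul_le_mul' (hcoef 1) le_rfl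
          _ = Valued.v x ^ 1 := by rw [one_mul, pow_one]
          _ ≤ Valued.v x ^ 2 := pow_le_pow_right₀ hlt.le (by norm_num)
      · rw [Valuation.map_mul, Valuation.map_pow]
        calc Valued.v (A.charpoly.coeff 2) * Valued.v x ^ 2 ≤ 1 * Valued.v x ^ 2 := mul_le_mul' (hcoef 2) le_rfl
          _ = Valued.v x ^ 2 := one_mul _
    exact absurd key (not_le_of_gt (pow_lt_pow_right₀ hlt (by norm_num)))
  -- (b) `(x − 1)³ = (charpoly 1 − charpoly A)(x)` has valuation `< 1`
  have hdeg : ((1 : Matrix (Fin 3) (Fin 3) K).charpoly - A.charpoly).natDegree < 4 :=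
    lt_of_le_of_lt ((Polynomial.natDegree_sub_le _ _).trans (by rw [hdeg1, hdegA, max_self])) (by norm_num)
  have hdiff : Valued.v (((1 : Matrix (Fin 3) (Fin 3) K).charpoly - A.charpoly).eval x) < 1 := by
    rw [Polynomial.eval_eq_sum_range' hdeg]
    refine Valuation.map_sum_lt _ one_ne_zero fun i hi => ?_
    rw [Finset.mem_range] at hi
    rw [coeff_sub, Valuation.map_mul, Valuation.map_pow]
    rcases (show i < 3 ∨ i = 3 by omega) with hi3 | rfl
    · rw [← neg_sub, Valuation.map_neg]
      calc Valued.v (A.charpoly.coeff i - (1 : Matrix (Fin 3) (Fin 3) K).charpoly.coeff i) * Valued.v x ^ i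
          ≤ Valued.v (A.charpoly.coeff i - (1 : Matrix (Fin 3) (Fin 3) K).charpoly.coeff i) * 1 :=
            mul_le_mul' le_rfl (pow_le_one₀ zero_le hx1)
        _ < 1 := by rw [mul_one]; exact h i hi3
    · rw [hb3, hc3, sub_self, map_zero, zero_mul]; exact zero_lt_one
  have e : (x - 1) ^ 3 = ((1 : Matrix (Fin 3) (Fin 3) K).charpoly - A.charpoly).eval x := by
    rw [eval_sub, hx.eq_zero, sub_zero, Matrix.charpoly_one, Fintype.card_fin, eval_pow, eval_sub, eval_X, eval_one]
  have hx3 : Valued.v (x - 1) ^ 3 < 1 := by rw [← Valuation.map_pow, e]; exact hdiff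
  by_contra hge
  rw [not_lt] at hge
  exact absurd hx3 (not_lt_of_ge (one_le_pow₀ hge))

end Deep

/-! ## §2 The κ-signed free row (parity bookkeeping) -/

/-- **The κ-signed ROW 2**: with `X = (q+1)² q^{N₁+N₂+N−2}` and the four literals' parity conditions (θ̄ = 0 at `(N₁,N₂,N)`, θ̄ = 1 at `(N₁,N₂,N)`, `(N,N₂,N₁)`, `(N₁,N,N₂)`),
`n₁₂ + n₂₂ − n₃₂ − n₄₂ = (−1)^{N₁+N₂}·X` (eight parity cases). [cite: Flicker1998UnitaryFL, §6 Thm. 15 p. 95] [cite: Rogawski1990, §4.9 Prop. 4.9.1 (a) p. 55] -/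
theorem kappa_free_row (q N₁ N₂ N : ℕ) :
    ((if (N₁ + N) % 2 = 0 ∧ (N₁ + N₂) % 2 = 0 then (((q + 1) ^ 2 * q ^ (N₁ + N₂ + N - 2) : ℕ) : ℚ) else 0) +
        (if (N₁ + N) % 2 = 1 ∧ (N₁ + N₂) % 2 = 0 then (((q + 1) ^ 2 * q ^ (N₁ + N₂ + N - 2) : ℕ) : ℚ) else 0)) -
      ((if (N + N₁) % 2 = 1 ∧ (N + N₂) % 2 = 0 then (((q + 1) ^ 2 * q ^ (N + N₂ + N₁ - 2) : ℕ) : ℚ) else 0) +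
        (if (N₁ + N₂) % 2 = 1 ∧ (N₁ + N) % 2 = 0 then (((q + 1) ^ 2 * q ^ (N₁ + N + N₂ - 2) : ℕ) : ℚ) else 0)) =
      (-1 : ℚ) ^ (N₁ + N₂) * ((q : ℚ) + 1) ^ 2 * (q : ℚ) ^ (N₁ + N₂ + N - 2) := by
  have e3 : N + N₂ + N₁ - 2 = N₁ + N₂ + N - 2 := by omega
  have e4 : N₁ + N + N₂ - 2 = N₁ + N₂ + N - 2 := by omega
  rw [e3, e4]
  push_cast
  rcases Nat.mod_two_eq_zero_or_one N₁ with h1 | h1 <;> rcases Nat.mod_two_eq_zero_or_one N₂ with h2 | h2 <;>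
    rcases Nat.mod_two_eq_zero_or_one N with h3 | h3
  all_goals
    have h12 : (N₁ + N₂) % 2 = (N₁ % 2 + N₂ % 2) % 2 := Nat.add_mod _ _ _
    have h13 : (N₁ + N) % 2 = (N₁ % 2 + N % 2) % 2 := Nat.add_mod _ _ _
    have h31 : (N + N₁) % 2 = (N % 2 + N₁ % 2) % 2 := Nat.add_mod _ _ _
    have h32 : (N + N₂) % 2 = (N % 2 + N₂ % 2) % 2 := Nat.add_mod _ _ _
    rw [h1, h2] at h12; rw [h1, h3] at h13; rw [h3, h1] at h31; rw [h3, h2] at h32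
    norm_num at h12 h13 h31 h32
    have hsgn : (-1 : ℚ) ^ (N₁ + N₂) = (-1 : ℚ) ^ ((N₁ + N₂) % 2) := by
      rw [← Nat.div_add_mod (N₁ + N₂) 2, pow_add, pow_mul]; norm_num
    rw [hsgn, h12]
    simp [h13, h31, h32]


/-! ## §3 The three strata counts of a literal are functions of its exponents (★ ROW-0, ★ ROW-2, ★ unit row) -/

section Counts

variable (L : Type) [Field L] [NumberField L] [IsCMField L] (H' : Matrix (Fin 3) (Fin 3) L)
  {v : HeightOneSpectrum (𝓞 ↥(maximalRealSubfield L))}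

set_option maxHeartbeats 400000 in
open scoped Classical in
/-- **THE THREE COUNTS AT A θ̄ = 1 LITERAL**: for `t ∈ G′_v` congruent (by the isometry `Tl`) to `t_π(x₁,x₂,x₃)` (norm one, pairwise distinct, ≡ 1 (mod 𝔪_w), exponents
`P, Q₁, Q₂`): `n₀(t) = φ₁(Q₁−1, P−1)` (★ ROW-0), `n₂(t) = [Q₁+P odd ∧ Q₁+Q₂ even]·(q+1)²q^{Q₁+Q₂+P−2}` (★ ROW-2), `n₀(t) + n₁(t) + n₂(t) = φ₁(Q₁, P)` (★ unit row) — so the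
three counts depend on the exponents only.  Binders = the union of the three ★ heads'. [cite: Rogawski1990, §4.9 Prop. 4.9.1 (b) p. 55, Lemma 4.9.3 p. 56]
[cite: Flicker1998UnitaryFL, Prop. 11 p. 87; §6 p. 95] [cite: Kottwitz1986, §3] -/
theorem rankStrata_counts_of_congr_flickerTorusElt
    (hH' : (H'.map (IsCMField.complexConj L))ᵀ = H') (hH'u : IsUnit H') (w : PlacesOver L v)
    (hw : IsCMField.complexConj L • w.1 = w.1) (hv : Algebra.IsUnramifiedIn (𝓞 L) v.asIdeal)
    (hH'w : IsUnit (placeForm H' w.1)) (hH'i : hH'w.unit ∈ glInt 3 (w.1.adicCompletion L))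
    (h2 : IsUnit (2 : 𝒪[w.1.adicCompletion L]))
    {e π π' y x₁ x₂ x₃ : LocalRing L v} (h2e : 2 * e = 1) (hσπ : conjLocal L (IsCMField.complexConj L) v π = π) (hππ : π * π' = 1)
    (hπN : ∀ z : LocalRing L v, conjLocal L (IsCMField.complexConj L) v z * z ≠ π)
    (hy : conjLocal L (IsCMField.complexConj L) v y * y = -2)
    (hx₁ : conjLocal L (IsCMField.complexConj L) v x₁ * x₁ = 1) (hx₂ : conjLocal L (IsCMField.complexConj L) v x₂ * x₂ = 1)
    (hx₃ : conjLocal L (IsCMField.complexConj L) v x₃ * x₃ = 1) (h₁₂ : x₁ ≠ x₂) (h₂₃ : x₂ ≠ x₃) (h₁₃ : x₁ ≠ x₃)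
    (Tl : GL (Fin 3) (LocalRing L v))
    (hTl : formCongr (conjLocal L (IsCMField.complexConj L) v) Tl (Matrix.of fun i j : Fin 3 => if i.val + j.val + 1 = 3 then (1 : LocalRing L v) else 0) =
      (adelicForm L 3 H').map (adeleToLocal L v))
    (ψ : ↥(UnitaryGroup.«local» L (IsCMField.complexConj L) 3 H' v) ≃ₜ*
        ↥(UnitaryGroup.«local» L (IsCMField.complexConj L) 3 (Matrix.of fun i j : Fin 3 => if i.val + j.val + 1 = 3 then (1 : L) else 0) v))
    (t : (cmDatum L 3 H').Local v)
    (hψ : ∀ g, (ψ g).val = Tl * g.val * Tl⁻¹)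
    (hlev : ∀ g, g ∈ cmLocalIntegralLevel L 3 H' v ↔
        ψ g ∈ cmLocalIntegralLevel L 3 (Matrix.of fun i j : Fin 3 => if i.val + j.val + 1 = 3 then (1 : L) else 0) v)
    (hlit : (ψ t).val.val =
          !![e * (x₁ + x₃), 0, -(e * (x₁ - x₃) * π); 0, x₂, 0; -(e * (x₁ - x₃) * π'), 0, e * (x₁ + x₃)])
    {P Q₁ Q₂ : ℕ} (hP : Valued.v (x₁ w - x₃ w) = WithZero.exp (-(P : ℤ))) (hQ₁ : Valued.v (x₁ w - x₂ w) = WithZero.exp (-(Q₁ : ℤ)))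
    (hQ₂ : Valued.v (x₃ w - x₂ w) = WithZero.exp (-(Q₂ : ℤ)))
    (hd₁ : Valued.v (x₁ w - 1) < 1) (hd₂ : Valued.v (x₂ w - 1) < 1) (hd₃ : Valued.v (x₃ w - 1) < 1) :
    (({q : (cmDatum L 3 H').Local v ⧸ cmLocalIntegralLevel L 3 H' v |
        q ∈ MulAction.fixedBy ((cmDatum L 3 H').Local v ⧸ cmLocalIntegralLevel L 3 H' v) t ∧
          (redMat ((((q.out⁻¹ * t * q.out : (cmDatum L 3 H').Local v)).val : GL (Fin 3) (LocalRing L v)).val.map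
            (Pi.evalRingHom (fun w' : PlacesOver L v => w'.1.adicCompletion L) w)) - 1).rank = 0}.ncard : ℕ) : ℚ) =
        Flicker1998.phiOne (Ideal.absNorm v.asIdeal) (Q₁ - 1) (P - 1) ∧
      (({q : (cmDatum L 3 H').Local v ⧸ cmLocalIntegralLevel L 3 H' v |
        q ∈ MulAction.fixedBy ((cmDatum L 3 H').Local v ⧸ cmLocalIntegralLevel L 3 H' v) t ∧
          (redMat ((((q.out⁻¹ * t * q.out : (cmDatum L 3 H').Local v)).val : GL (Fin 3) (LocalRing L v)).val.map
            (Pi.evalRingHom (fun w' : PlacesOver L v => w'.1.adicCompletion L) w)) - 1).rank = 2}.ncard : ℕ) : ℚ) =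
        (if (Q₁ + P) % 2 = 1 ∧ (Q₁ + Q₂) % 2 = 0 then
          (((Ideal.absNorm v.asIdeal + 1) ^ 2 * Ideal.absNorm v.asIdeal ^ (Q₁ + Q₂ + P - 2) : ℕ) : ℚ) else 0) ∧
      (({q : (cmDatum L 3 H').Local v ⧸ cmLocalIntegralLevel L 3 H' v |
        q ∈ MulAction.fixedBy ((cmDatum L 3 H').Local v ⧸ cmLocalIntegralLevel L 3 H' v) t ∧
          (redMat ((((q.out⁻¹ * t * q.out : (cmDatum L 3 H').Local v)).val : GL (Fin 3) (LocalRing L v)).val.map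
            (Pi.evalRingHom (fun w' : PlacesOver L v => w'.1.adicCompletion L) w)) - 1).rank = 0}.ncard : ℕ) : ℚ) +
        (({q : (cmDatum L 3 H').Local v ⧸ cmLocalIntegralLevel L 3 H' v |
        q ∈ MulAction.fixedBy ((cmDatum L 3 H').Local v ⧸ cmLocalIntegralLevel L 3 H' v) t ∧
          (redMat ((((q.out⁻¹ * t * q.out : (cmDatum L 3 H').Local v)).val : GL (Fin 3) (LocalRing L v)).val.map
            (Pi.evalRingHom (fun w' : PlacesOver L v => w'.1.adicCompletion L) w)) - 1).rank = 1}.ncard : ℕ) : ℚ) +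
        (({q : (cmDatum L 3 H').Local v ⧸ cmLocalIntegralLevel L 3 H' v |
        q ∈ MulAction.fixedBy ((cmDatum L 3 H').Local v ⧸ cmLocalIntegralLevel L 3 H' v) t ∧
          (redMat ((((q.out⁻¹ * t * q.out : (cmDatum L 3 H').Local v)).val : GL (Fin 3) (LocalRing L v)).val.map
            (Pi.evalRingHom (fun w' : PlacesOver L v => w'.1.adicCompletion L) w)) - 1).rank = 2}.ncard : ℕ) : ℚ) =
        Flicker1998.phiOne (Ideal.absNorm v.asIdeal) Q₁ P := by
  refine ⟨ncard_rankStratum_zero_eq_phiOne_of_congr L H' hH' hH'u w hw hv h2 h2e hσπ hππ hπN hy hx₁ hx₂ hx₃ h₁₂ h₂₃ h₁₃ Tl ψ t hψ hlev hlit hP hQ₁ hQ₂ hd₁ hd₂ hd₃,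
    ncard_rankStratum_two_eq_of_congr L H' hH' w hw hv hH'w hH'i h2 h2e hσπ hππ hπN hx₁ hx₂ hx₃ Tl hTl ψ t hψ hlit hP hQ₁ hQ₂ hd₁ hd₂ hd₃, ?_⟩
  have hs := sum_ncard_rankStrata_eq_phiOne_of_congr L H' hH' hH'u w hw hv h2 h2e hσπ hππ hπN hy hx₁ hx₂ hx₃ h₁₂ h₂₃ h₁₃ Tl ψ t hψ hlev hlit hP hQ₁ hQ₂ hd₁ hd₂ hd₃
  simpa only [Finset.sum_range_succ, Finset.sum_range_zero, zero_add, Nat.cast_add] using hs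

set_option maxHeartbeats 400000 in
open scoped Classical in
/-- **THE THREE COUNTS AT THE θ̄ = 0 LITERAL** `t_1(x₁,x₂,x₃)`: `n₀(t) = φ₀(Q₁−1, Q₂−1, P−1)` (★ ROW-0), `n₂(t) = [Q₁+P even ∧ Q₁+Q₂ even]·(q+1)²q^{Q₁+Q₂+P−2}` (★ ROW-2),
`n₀(t) + n₁(t) + n₂(t) = φ₀(Q₁, Q₂, P)` (★ unit row). [cite: Rogawski1990, §4.9 Prop. 4.9.1 (b) p. 55, Lemma 4.9.3 p. 56] [cite: Flicker1998UnitaryFL, Props. 13–14 pp. 91–94; §6 p. 95]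
[cite: Kottwitz1986, §3] -/
theorem rankStrata_counts_of_congr_flickerTorusEltOne
    (hH' : (H'.map (IsCMField.complexConj L))ᵀ = H') (hH'u : IsUnit H') (w : PlacesOver L v)
    (hw : IsCMField.complexConj L • w.1 = w.1) (hv : Algebra.IsUnramifiedIn (𝓞 L) v.asIdeal)
    (hH'w : IsUnit (placeForm H' w.1)) (hH'i : hH'w.unit ∈ glInt 3 (w.1.adicCompletion L))
    (h2 : IsUnit (2 : 𝒪[w.1.adicCompletion L]))
    {e y x₁ x₂ x₃ : LocalRing L v} (h2e : 2 * e = 1)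
    (hy : conjLocal L (IsCMField.complexConj L) v y * y = -2)
    (hx₁ : conjLocal L (IsCMField.complexConj L) v x₁ * x₁ = 1) (hx₂ : conjLocal L (IsCMField.complexConj L) v x₂ * x₂ = 1)
    (hx₃ : conjLocal L (IsCMField.complexConj L) v x₃ * x₃ = 1) (h₁₂ : x₁ ≠ x₂) (h₂₃ : x₂ ≠ x₃) (h₁₃ : x₁ ≠ x₃)
    (Tl : GL (Fin 3) (LocalRing L v))
    (hTl : formCongr (conjLocal L (IsCMField.complexConj L) v) Tl (Matrix.of fun i j : Fin 3 => if i.val + j.val + 1 = 3 then (1 : LocalRing L v) else 0) =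
      (adelicForm L 3 H').map (adeleToLocal L v))
    (ψ : ↥(UnitaryGroup.«local» L (IsCMField.complexConj L) 3 H' v) ≃ₜ*
        ↥(UnitaryGroup.«local» L (IsCMField.complexConj L) 3 (Matrix.of fun i j : Fin 3 => if i.val + j.val + 1 = 3 then (1 : L) else 0) v))
    (t : (cmDatum L 3 H').Local v)
    (hψ : ∀ g, (ψ g).val = Tl * g.val * Tl⁻¹)
    (hlev : ∀ g, g ∈ cmLocalIntegralLevel L 3 H' v ↔
        ψ g ∈ cmLocalIntegralLevel L 3 (Matrix.of fun i j : Fin 3 => if i.val + j.val + 1 = 3 then (1 : L) else 0) v)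
    (hlit : (ψ t).val.val =
          !![e * (x₁ + x₃), 0, -(e * (x₁ - x₃)); 0, x₂, 0; -(e * (x₁ - x₃)), 0, e * (x₁ + x₃)])
    {P Q₁ Q₂ : ℕ} (hP : Valued.v (x₁ w - x₃ w) = WithZero.exp (-(P : ℤ))) (hQ₁ : Valued.v (x₁ w - x₂ w) = WithZero.exp (-(Q₁ : ℤ)))
    (hQ₂ : Valued.v (x₃ w - x₂ w) = WithZero.exp (-(Q₂ : ℤ)))
    (htri : (Q₁ = Q₂ ∧ Q₁ ≤ P) ∨ (Q₁ = P ∧ Q₁ ≤ Q₂) ∨ (Q₂ = P ∧ Q₂ ≤ Q₁))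
    (hd₁ : Valued.v (x₁ w - 1) < 1) (hd₂ : Valued.v (x₂ w - 1) < 1) (hd₃ : Valued.v (x₃ w - 1) < 1) :
    (({q : (cmDatum L 3 H').Local v ⧸ cmLocalIntegralLevel L 3 H' v |
        q ∈ MulAction.fixedBy ((cmDatum L 3 H').Local v ⧸ cmLocalIntegralLevel L 3 H' v) t ∧
          (redMat ((((q.out⁻¹ * t * q.out : (cmDatum L 3 H').Local v)).val : GL (Fin 3) (LocalRing L v)).val.map
            (Pi.evalRingHom (fun w' : PlacesOver L v => w'.1.adicCompletion L) w)) - 1).rank = 0}.ncard : ℕ) : ℚ) =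
        Flicker1998.phiZero (Ideal.absNorm v.asIdeal) (Q₁ - 1) (Q₂ - 1) (P - 1) ∧
      (({q : (cmDatum L 3 H').Local v ⧸ cmLocalIntegralLevel L 3 H' v |
        q ∈ MulAction.fixedBy ((cmDatum L 3 H').Local v ⧸ cmLocalIntegralLevel L 3 H' v) t ∧
          (redMat ((((q.out⁻¹ * t * q.out : (cmDatum L 3 H').Local v)).val : GL (Fin 3) (LocalRing L v)).val.map
            (Pi.evalRingHom (fun w' : PlacesOver L v => w'.1.adicCompletion L) w)) - 1).rank = 2}.ncard : ℕ) : ℚ) =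
        (if (Q₁ + P) % 2 = 0 ∧ (Q₁ + Q₂) % 2 = 0 then
          (((Ideal.absNorm v.asIdeal + 1) ^ 2 * Ideal.absNorm v.asIdeal ^ (Q₁ + Q₂ + P - 2) : ℕ) : ℚ) else 0) ∧
      (({q : (cmDatum L 3 H').Local v ⧸ cmLocalIntegralLevel L 3 H' v |
        q ∈ MulAction.fixedBy ((cmDatum L 3 H').Local v ⧸ cmLocalIntegralLevel L 3 H' v) t ∧
          (redMat ((((q.out⁻¹ * t * q.out : (cmDatum L 3 H').Local v)).val : GL (Fin 3) (LocalRing L v)).val.map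
            (Pi.evalRingHom (fun w' : PlacesOver L v => w'.1.adicCompletion L) w)) - 1).rank = 0}.ncard : ℕ) : ℚ) +
        (({q : (cmDatum L 3 H').Local v ⧸ cmLocalIntegralLevel L 3 H' v |
        q ∈ MulAction.fixedBy ((cmDatum L 3 H').Local v ⧸ cmLocalIntegralLevel L 3 H' v) t ∧
          (redMat ((((q.out⁻¹ * t * q.out : (cmDatum L 3 H').Local v)).val : GL (Fin 3) (LocalRing L v)).val.map
            (Pi.evalRingHom (fun w' : PlacesOver L v => w'.1.adicCompletion L) w)) - 1).rank = 1}.ncard : ℕ) : ℚ) +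
        (({q : (cmDatum L 3 H').Local v ⧸ cmLocalIntegralLevel L 3 H' v |
        q ∈ MulAction.fixedBy ((cmDatum L 3 H').Local v ⧸ cmLocalIntegralLevel L 3 H' v) t ∧
          (redMat ((((q.out⁻¹ * t * q.out : (cmDatum L 3 H').Local v)).val : GL (Fin 3) (LocalRing L v)).val.map
            (Pi.evalRingHom (fun w' : PlacesOver L v => w'.1.adicCompletion L) w)) - 1).rank = 2}.ncard : ℕ) : ℚ) =
        Flicker1998.phiZero (Ideal.absNorm v.asIdeal) Q₁ Q₂ P := by
  refine ⟨ncard_rankStratum_zero_eq_phiZero_of_congr L H' hH' hH'u w hw hv h2 h2e hy hx₁ hx₂ hx₃ h₁₂ h₂₃ h₁₃ Tl ψ t hψ hlev hlit hP hQ₁ hQ₂ htri hd₁ hd₂ hd₃,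
    ncard_rankStratum_two_eq_of_congr_one L H' hH' w hw hv hH'w hH'i h2 h2e hx₁ hx₂ hx₃ Tl hTl ψ t hψ hlit hP hQ₁ hQ₂ hd₁ hd₂ hd₃, ?_⟩
  have hs := sum_ncard_rankStrata_eq_phiZero_of_congr L H' hH' hH'u w hw hv h2 h2e hy hx₁ hx₂ hx₃ h₁₂ h₂₃ h₁₃ Tl ψ t hψ hlev hlit hP hQ₁ hQ₂ htri hd₁ hd₂ hd₃
  simpa only [Finset.sum_range_succ, Finset.sum_range_zero, zero_add, Nat.cast_add] using hs

end Counts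

end Literature.NumberTheory.Rogawski1990

end
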